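import Mathlib
import HarnessLib
import Literature.MathematicalPhysics.QuantumManyBody.BoseEinsteinCondensation

/-!
# Crux `ParticleTensorisation` (stmt-AtomisticToContinuum-14367) — transfer lemmas for the
# division-free approximate-tensorisation (AT) clause

The crux `Summit.AtomisticToContinuum.BoseEinsteinCondensation.Theses.BECHeatBathGap.ParticleTensorisation`
asserts, for some near-minimiser `Θ`, the clause
`∀ F g (bounded measurable, gᵢ blind to xᵢ), ∃ c, ∫⁻ ‖F - cΘ‖₊² ≤ C Σᵢ ∫⁻ ‖F - gᵢΘ‖₊²`
("approximate tensorisation of variance of `|Θ|²` over particle labels with constant `C`", stated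
without dividing by `Θ`). This file records the two elementary TRANSFER facts about that clause which
every analysis of the crux uses (line records `Cruxes/ParticleTensorisation/Lines/registered-dead*.md`):

* `clause_mul_of_clause` — **Holley–Stroock in division-free form**: if the clause holds for the
  amplitude `Θ` with constant `C` and `h` is measurable with `m ≤ ‖h‖ ≤ M'` pointwise (`0 < m`), then
  it holds for `h·Θ` with constant `(M'/m)² C` (apply the hypothesis to `F/h`; the predictors `gᵢ` are
  unchanged, so no blindness is lost). Stated for an arbitrary measure on configuration space, so it
  applies verbatim to `volume.restrict (boxN N L)`.

Nothing here touches the crux itself; these are tools (`--supports`).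
-/

noncomputable section

namespace Summit.AtomisticToContinuum.BoseEinsteinCondensation.Theorems.ATClause

open MeasureTheory Function Finset Set Filter
open scoped ENNReal Topology
open Literature.MathematicalPhysics.QuantumManyBody.BoseGas

variable {N : ℕ}

/-- Pointwise factorisation behind the division-free Holley–Stroock transfer:
`F - c·(hΘ) = h·(F/h - cΘ)` when `h ≠ 0`, in `ℝ≥0∞`-valued squared norms. [folklore] -/
theorem coe_nnnorm_sub_mul_mul_sq {F h Θ c : ℂ} (hh : h ≠ 0) :
    ((‖F - c * (h * Θ)‖₊ : ℝ≥0∞)) ^ 2 = ((‖h‖₊ : ℝ≥0∞)) ^ 2 * ((‖F / h - c * Θ‖₊ : ℝ≥0∞)) ^ 2 := by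
  rw [← mul_pow, ← ENNReal.coe_mul, ← nnnorm_mul]
  congr 3
  field_simp

/-- Pointwise lower bound behind the division-free Holley–Stroock transfer: if `m ≤ ‖h‖` with
`0 < m` then `‖F/h - gΘ‖² ≤ (1/m)² ‖F - g(hΘ)‖²`, in `ℝ≥0∞`. [folklore] -/
theorem coe_nnnorm_div_sub_sq_le {F h Θ g : ℂ} {m : ℝ} (hm : 0 < m) (hmh : m ≤ ‖h‖) :
    ((‖F / h - g * Θ‖₊ : ℝ≥0∞)) ^ 2 ≤
      ENNReal.ofReal ((1 / m) ^ 2) * ((‖F - g * (h * Θ)‖₊ : ℝ≥0∞)) ^ 2 := by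
  have hh : h ≠ 0 := fun h0 => by rw [h0, norm_zero] at hmh; linarith
  have hnorm : ‖F / h - g * Θ‖ = ‖F - g * (h * Θ)‖ / ‖h‖ := by
    rw [← norm_div]; congr 1; field_simp
  have hle : ‖F / h - g * Θ‖ ≤ (1 / m) * ‖F - g * (h * Θ)‖ := by
    rw [hnorm, div_eq_mul_inv, mul_comm, one_div]
    exact mul_le_mul_of_nonneg_right (inv_anti₀ hm hmh) (norm_nonneg _)
  have h2 : ‖F / h - g * Θ‖ ^ 2 ≤ (1 / m) ^ 2 * ‖F - g * (h * Θ)‖ ^ 2 := by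
    rw [← mul_pow]; exact pow_le_pow_left₀ (norm_nonneg _) hle 2
  calc ((‖F / h - g * Θ‖₊ : ℝ≥0∞)) ^ 2 = ENNReal.ofReal (‖F / h - g * Θ‖ ^ 2) := by
        rw [ENNReal.ofReal_pow (norm_nonneg _), ofReal_norm, enorm_eq_nnnorm]
    _ ≤ ENNReal.ofReal ((1 / m) ^ 2 * ‖F - g * (h * Θ)‖ ^ 2) := ENNReal.ofReal_le_ofReal h2
    _ = ENNReal.ofReal ((1 / m) ^ 2) * ((‖F - g * (h * Θ)‖₊ : ℝ≥0∞)) ^ 2 := by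
        rw [ENNReal.ofReal_mul (by positivity), ENNReal.ofReal_pow (norm_nonneg _),
          ofReal_norm, enorm_eq_nnnorm]

/-- **Holley–Stroock transfer for the division-free AT clause (bounded multiplicative dressing of the
amplitude).** If the approximate-tensorisation clause holds for the amplitude `Θ` with constant `C`
(w.r.t. any measure `μ` on `N`-particle configuration space) and `h` is measurable with
`m ≤ ‖h X‖ ≤ M'` for all `X` (`0 < m`), then the clause holds for the dressed amplitude `h·Θ` with
constant `(M'/m)² C`: apply the hypothesis to the bounded measurable `F/h` with the SAME predictors
`gᵢ` (still blind to `xᵢ`), and compare pointwise via `F - c(hΘ) = h(F/h - cΘ)`,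
`F - gᵢ(hΘ) = h(F/h - gᵢΘ)`. This is the only transfer principle that is valid for every reference
amplitude; its constant is idle when `log(M'/m)` grows with `N` (e.g. `h = e^{-E/2}` with an
extensive pair energy `E`). [folklore] -/
theorem clause_mul_of_clause (μ : Measure (Fin N → Space)) {Θ h : (Fin N → Space) → ℂ}
    (hh : Measurable h) {m M' C : ℝ} (hm : 0 < m) (hmh : ∀ X, m ≤ ‖h X‖) (hhM : ∀ X, ‖h X‖ ≤ M')
    (hC : 0 ≤ C)
    (hAT : ∀ (F : (Fin N → Space) → ℂ) (g : Fin N → (Fin N → Space) → ℂ), Measurable F →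
      (∀ i, Measurable (g i)) → (∃ M : ℝ, ∀ X, ‖F X‖ ≤ M ∧ ∀ i, ‖g i X‖ ≤ M) →
      (∀ i X x, g i (Function.update X i x) = g i X) →
      ∃ c : ℂ, (∫⁻ X, (‖F X - c * Θ X‖₊ : ℝ≥0∞) ^ 2 ∂μ) ≤
        ENNReal.ofReal C * ∑ i : Fin N, ∫⁻ X, (‖F X - g i X * Θ X‖₊ : ℝ≥0∞) ^ 2 ∂μ) :
    ∀ (F : (Fin N → Space) → ℂ) (g : Fin N → (Fin N → Space) → ℂ), Measurable F →
      (∀ i, Measurable (g i)) → (∃ M : ℝ, ∀ X, ‖F X‖ ≤ M ∧ ∀ i, ‖g i X‖ ≤ M) →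
      (∀ i X x, g i (Function.update X i x) = g i X) →
      ∃ c : ℂ, (∫⁻ X, (‖F X - c * (h X * Θ X)‖₊ : ℝ≥0∞) ^ 2 ∂μ) ≤
        ENNReal.ofReal ((M' / m) ^ 2 * C) *
          ∑ i : Fin N, ∫⁻ X, (‖F X - g i X * (h X * Θ X)‖₊ : ℝ≥0∞) ^ 2 ∂μ := by
  intro F g hF hg hFg hupd
  obtain ⟨M, hM⟩ := hFg
  have hh0 : ∀ X, h X ≠ 0 := fun X h0 => by
    have := hmh X; rw [h0, norm_zero] at this; linarith
  have hM' : 0 ≤ M' := by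
    rcases isEmpty_or_nonempty (Fin N → Space) with hE | ⟨⟨X⟩⟩
    · exact (hE.false (fun _ => 0)).elim
    · exact le_trans (le_trans hm.le (hmh X)) (hhM X)
  -- the hypothesis applied to `F/h` with the same predictors
  have hbound : ∃ M₁ : ℝ, ∀ X, ‖F X / h X‖ ≤ M₁ ∧ ∀ i, ‖g i X‖ ≤ M₁ := by
    refine ⟨max (M / m) M, fun X => ⟨?_, fun i => ((hM X).2 i).trans (le_max_right _ _)⟩⟩
    refine le_trans ?_ (le_max_left _ _)
    rw [norm_div, div_le_div_iff₀ (lt_of_lt_of_le hm (hmh X)) hm]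
    exact mul_le_mul (hM X).1 (hmh X) hm.le (le_trans (norm_nonneg _) (hM X).1)
  obtain ⟨c, hc⟩ := hAT (fun X => F X / h X) g (hF.div hh) hg hbound hupd
  refine ⟨c, ?_⟩
  -- left-hand side: `∫ ‖F - c hΘ‖² ≤ M'² ∫ ‖F/h - cΘ‖²`
  have h1 : (∫⁻ X, (‖F X - c * (h X * Θ X)‖₊ : ℝ≥0∞) ^ 2 ∂μ) ≤
      ENNReal.ofReal (M' ^ 2) * ∫⁻ X, (‖F X / h X - c * Θ X‖₊ : ℝ≥0∞) ^ 2 ∂μ := by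
    rw [← lintegral_const_mul' _ _ ENNReal.ofReal_ne_top]
    refine lintegral_mono fun X => ?_
    rw [coe_nnnorm_sub_mul_mul_sq (hh0 X)]
    gcongr
    calc ((‖h X‖₊ : ℝ≥0∞)) ^ 2 = ENNReal.ofReal (‖h X‖ ^ 2) := by
          rw [ENNReal.ofReal_pow (norm_nonneg _), ofReal_norm, enorm_eq_nnnorm]
      _ ≤ ENNReal.ofReal (M' ^ 2) :=
          ENNReal.ofReal_le_ofReal (pow_le_pow_left₀ (norm_nonneg _) (hhM X) 2)
  -- right-hand side, termwise: `∫ ‖F/h - gᵢΘ‖² ≤ (1/m)² ∫ ‖F - gᵢ hΘ‖²`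
  have h2 : ∀ i, (∫⁻ X, (‖F X / h X - g i X * Θ X‖₊ : ℝ≥0∞) ^ 2 ∂μ) ≤
      ENNReal.ofReal ((1 / m) ^ 2) * ∫⁻ X, (‖F X - g i X * (h X * Θ X)‖₊ : ℝ≥0∞) ^ 2 ∂μ := by
    intro i
    rw [← lintegral_const_mul' _ _ ENNReal.ofReal_ne_top]
    exact lintegral_mono fun X => coe_nnnorm_div_sub_sq_le hm (hmh X)
  calc (∫⁻ X, (‖F X - c * (h X * Θ X)‖₊ : ℝ≥0∞) ^ 2 ∂μ)
      ≤ ENNReal.ofReal (M' ^ 2) * (ENNReal.ofReal C *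
          ∑ i : Fin N, ∫⁻ X, (‖F X / h X - g i X * Θ X‖₊ : ℝ≥0∞) ^ 2 ∂μ) :=
        h1.trans (mul_le_mul' le_rfl hc)
    _ ≤ ENNReal.ofReal (M' ^ 2) * (ENNReal.ofReal C *
          ∑ i : Fin N, (ENNReal.ofReal ((1 / m) ^ 2) *
            ∫⁻ X, (‖F X - g i X * (h X * Θ X)‖₊ : ℝ≥0∞) ^ 2 ∂μ)) := by
        gcongr with i
        exact h2 i
    _ = ENNReal.ofReal ((M' / m) ^ 2 * C) *
          ∑ i : Fin N, ∫⁻ X, (‖F X - g i X * (h X * Θ X)‖₊ : ℝ≥0∞) ^ 2 ∂μ := by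
        rw [← Finset.mul_sum, ← mul_assoc, ← mul_assoc, ← ENNReal.ofReal_mul (by positivity),
          ← ENNReal.ofReal_mul (by positivity)]
        congr 2
        field_simp

end Summit.AtomisticToContinuum.BoseEinsteinCondensation.Theorems.ATClause
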